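import Summits.FinalStateConjecture.FinalStateConjecture.Theses.HomotheticSurfaceGravity
import Summits.FinalStateConjecture.FinalStateConjecture.Theorems.CurvatureOrSymmetryMinimalSingularTipChains

/-!
# Crux `NakedTangentProfile` (stmt-FinalStateConjecture-17353) — line `first-naked-point-zorn`
(crux-strategist 2026-08-17; registered skeleton = the typed decomposition of the crux)

Three REGISTERED STUBS, each a genuine piece of the crux (none the crux reworded, none the summit —
per-piece probes `stub → FinalStateConjecture`, `stub → NakedTangentProfile` and their converses all
fail under `exact? | simpa | aesop`, 12/12), and the kernel-checked composition
`NakedTangentProfile_of : A → B → C → NakedTangentProfile`: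

* `stub_visibleEndlessObserver` (A) — LOCALISATION: incomplete sojourn-`𝓘⁺` ⇒ exit ∨ a future-endless
  timelike curve (an observer falling into the singular future boundary) whose whole world-line is
  seen by the incompleteness-witnessing far rays (`IsVisibleFromInfinity (γ₀ '' s₀)`);
* `stub_noTIPCascade` (B) — NO ZENO CASCADE: inside a visible TIP, below every antitone sequence of
  TIPs runs a future-endless timelike curve (exit ∨ …);
* `stub_profileAtFirstNakedPoint` (C) — BLOW-UP AT EVERY FIRST NAKED POINT: exit ∨ a nonflat smooth
  self-similar vacuum `C²` tangent profile.

The composition is not a re-bracketing: pasts of visible sets are visible; an endless timelike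
curve generates a TIP below every TIP it threads; the LANDED order-theoretic reduction
`cauchyDevelopment_exists_isMinimalTIP_subset_of_seq` (Zorn on TIPs + countable coinitiality of
chains of open sets, Theorems/CurvatureOrSymmetryMinimalSingularTipChains) produces a `⊆`-minimal
TIP inside the visible TIP `I⁻(γ₀(s₀))`; antitone visibility makes it a first naked point under the
development's Levi-Civita binder; (C) is dispatched there. The same three statements are the
children of the split `NakedTangentProfile ⇐ A, B, C` (children.json in this crux directory) and
the same proof, with verbatim hypotheses, is `Theorems.nakedTangentProfile_of_subs` (evidence
Split.lean on the crux item, to be landed by a prover as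
Theorems/HomotheticSurfaceGravityNakedTangentProfileSplit.lean).
-/

set_option linter.dupNamespace false

namespace Summit.FinalStateConjecture.FinalStateConjecture.Cruxes.NakedTangentProfile.FirstNakedPointZorn

open Set Filter Function
open scoped Manifold ContDiff Topology
open Literature.Geometry.Lorentzian
open Summit.FinalStateConjecture.FinalStateConjecture.Theses.HomotheticSurfaceGravity
open Summit.FinalStateConjecture.FinalStateConjecture.Theorems

/-! ## The three registered stubs (= the pieces A, B, C) -/

/-- **Stub A — the incompleteness of `𝓘⁺` is localised at a visible endless observer.** For an
admissible datum `D` and a maximal vacuum Cauchy development `𝒟` with incomplete sojourn-`𝓘⁺`: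
exit, or a future-directed timelike curve `γ₀` without future endpoint whose image is visible from
infinity. Inputs foreseen: exterior stability (Klainerman–Nicolò) to confine the ends of the
witnessing rays; a common past for the visible part of the future boundary. -/
theorem stub_visibleEndlessObserver :
    ∀ (X : Type) [TopologicalSpace X] [ChartedSpace Literature.Geometry.Lorentzian.E3 X] [IsManifold (𝓡 3) ((⊤ : ℕ∞) : WithTop ℕ∞) X] [T2Space X] [SecondCountableTopology X] [ConnectedSpace X], ∀ D ∈ Literature.Geometry.Lorentzian.admissibleVacuumData X, ∀ 𝒟 : Literature.Geometry.Lorentzian.VacuumCauchyDevelopment D, 𝒟.IsMaximal → ¬ Summit.FinalStateConjecture.HasCompleteNullInfinity 𝒟.toCauchyDevelopment → (∃ (e : Literature.Geometry.Lorentzian.AFEnd X) (F : EuclideanSpace ℝ (Fin 1) → Literature.Geometry.Lorentzian.InitialDataSet (𝓡 3) X), Literature.Geometry.Lorentzian.InitialDataSet.IsTameDataFamily e 1 F ∧ Literature.Geometry.Lorentzian.InitialDataSet.IsImmersedAtZero 1 F ∧ F 0 = D ∧ Function.Injective F ∧ (∀ c, F c ∈ Literature.Geometry.Lorentzian.admissibleVacuumData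 X) ∧ ∃ ε : ℝ, 0 < ε ∧ ∀ c, c ≠ 0 → ‖c‖ < ε → ((∃ 𝒟' : Literature.Geometry.Lorentzian.VacuumCauchyDevelopment (F c), 𝒟'.IsMaximal) ∧ ∀ 𝒟' : Literature.Geometry.Lorentzian.VacuumCauchyDevelopment (F c), 𝒟'.IsMaximal → Summit.FinalStateConjecture.HasCompleteNullInfinity 𝒟'.toCauchyDevelopment ∧ ∃ (O : Set 𝒟'.carrier) (d : Literature.Geometry.Lorentzian.FinalStateDecomposition 𝒟'.toSpacetime O 2), (∀ i, Literature.Geometry.Lorentzian.Kerr.IsSubextremal (d.mass i) (d.spin i)) ∧ O = Summit.FinalStateConjecture.exteriorOf 𝒟'.toCauchyDevelopment d.charted ∧ Summit.FinalStateConjecture.RaysStayInClosure 𝒟'.toCauchyDevelopment O ∧ Summit.FinalStateConjecture.HasExhaustiveCharts d ∧ Summit.FinalStateConjecture.IsFutureOriented d)) ∨ ∃ (γ₀ : ℝ → 𝒟.carrier) (s₀ : Set ℝ), s₀.OrdConnected ∧ 𝒟.metric.IsFutureTimelikeCurveOn 𝒟.timeOrientation γ₀ s₀ ∧ Literature.Geometry.Lorentzian.IsFutureEndless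 γ₀ s₀ ∧ ∀ [𝒟.metric.HasLeviCivita], 𝒟.metric.IsVisibleFromInfinity 𝒟.timeOrientation 𝒟.embed 𝒟.normal (γ₀ '' s₀) := by
  sorry

/-- **Stub B — no Zeno cascade of visible ideal points.** Inside a visible TIP `W₀` of a maximal
vacuum Cauchy development of admissible data, below every antitone sequence of TIPs runs a
future-endless timelike curve (or the datum exits). Inputs foreseen: the Cauchy hypersurface and
the sojourn bounds (vertices cannot recede to `Σ` or to infinity), Cauchy stability / breakdown
criterion (ideal points cannot accumulate at an interior event). -/
theorem stub_noTIPCascade :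
    ∀ (X : Type) [TopologicalSpace X] [ChartedSpace Literature.Geometry.Lorentzian.E3 X] [IsManifold (𝓡 3) ((⊤ : ℕ∞) : WithTop ℕ∞) X] [T2Space X] [SecondCountableTopology X] [ConnectedSpace X], ∀ D ∈ Literature.Geometry.Lorentzian.admissibleVacuumData X, ∀ 𝒟 : Literature.Geometry.Lorentzian.VacuumCauchyDevelopment D, 𝒟.IsMaximal → ∀ W₀ : Set 𝒟.carrier, 𝒟.metric.IsTIP 𝒟.timeOrientation W₀ → (∀ [𝒟.metric.HasLeviCivita], 𝒟.metric.IsVisibleFromInfinity 𝒟.timeOrientation 𝒟.embed 𝒟.normal W₀) → ∀ P : ℕ → Set 𝒟.carrier, (∀ k, 𝒟.metric.IsTIP 𝒟.timeOrientation (P k)) → (∀ k, P k ⊆ W₀) → Antitone P → (∃ (e : Literature.Geometry.Lorentzian.AFEnd X) (F : EuclideanSpace ℝ (Fin 1) → Literature.Geometry.Lorentzian.InitialDataSet (𝓡 3) X), Literature.Geometry.Lorentzian.InitialDataSet.IsTameDataFamily e 1 F ∧ Literature.Geometry.Lorentzian.InitialDataSet.IsImmersedAtZero 1 F ∧ F 0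 = D ∧ Function.Injective F ∧ (∀ c, F c ∈ Literature.Geometry.Lorentzian.admissibleVacuumData X) ∧ ∃ ε : ℝ, 0 < ε ∧ ∀ c, c ≠ 0 → ‖c‖ < ε → ((∃ 𝒟' : Literature.Geometry.Lorentzian.VacuumCauchyDevelopment (F c), 𝒟'.IsMaximal) ∧ ∀ 𝒟' : Literature.Geometry.Lorentzian.VacuumCauchyDevelopment (F c), 𝒟'.IsMaximal → Summit.FinalStateConjecture.HasCompleteNullInfinity 𝒟'.toCauchyDevelopment ∧ ∃ (O : Set 𝒟'.carrier) (d : Literature.Geometry.Lorentzian.FinalStateDecomposition 𝒟'.toSpacetime O 2), (∀ i, Literature.Geometry.Lorentzian.Kerr.IsSubextremal (d.mass i) (d.spin i)) ∧ O = Summit.FinalStateConjecture.exteriorOf 𝒟'.toCauchyDevelopment d.charted ∧ Summit.FinalStateConjecture.RaysStayInClosure 𝒟'.toCauchyDevelopment O ∧ Summit.FinalStateConjecture.HasExhaustiveCharts d ∧ Summit.FinalStateConjecture.IsFutureOriented d)) ∨ ∃ (γ : ℝ → 𝒟.carrier) (s : Set ℝ), s.OrdConnected ∧ 𝒟.metric.IsFutureTimelikeCurveOn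 𝒟.timeOrientation γ s ∧ Literature.Geometry.Lorentzian.IsFutureEndless γ s ∧ ∀ k, γ '' s ⊆ P k := by
  sorry

/-- **Stub C — blow-up at every first naked point.** At every first naked point of a maximal vacuum
Cauchy development of admissible data: exit, or a nonflat smooth self-similar vacuum `C²` tangent
profile. Inputs foreseen: scale-critical compactness modulo scaling and gauge (self-similar
extraction), Type-II exclusion/exit, non-flatness by `ε`-regularity, regularity of the limit across
its cone. -/
theorem stub_profileAtFirstNakedPoint :
    ∀ (X : Type) [TopologicalSpace X] [ChartedSpace Literature.Geometry.Lorentzian.E3 X] [IsManifold (𝓡 3) ((⊤ : ℕ∞) : WithTop ℕ∞) X] [T2Space X] [SecondCountableTopology X] [ConnectedSpace X], ∀ D ∈ Literature.Geometry.Lorentzian.admissibleVacuumData X, ∀ 𝒟 : Literature.Geometry.Lorentzian.VacuumCauchyDevelopment D, 𝒟.IsMaximal → ∀ P : Set 𝒟.carrier, 𝒟.toCauchyDevelopment.FirstNakedPoint P → (∃ (e : Literature.Geometry.Lorentzian.AFEnd X) (F : EuclideanSpace ℝ (Fin 1) → Literature.Geometry.Lorentzian.InitialDataSet (𝓡 3)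 X), Literature.Geometry.Lorentzian.InitialDataSet.IsTameDataFamily e 1 F ∧ Literature.Geometry.Lorentzian.InitialDataSet.IsImmersedAtZero 1 F ∧ F 0 = D ∧ Function.Injective F ∧ (∀ c, F c ∈ Literature.Geometry.Lorentzian.admissibleVacuumData X) ∧ ∃ ε : ℝ, 0 < ε ∧ ∀ c, c ≠ 0 → ‖c‖ < ε → ((∃ 𝒟' : Literature.Geometry.Lorentzian.VacuumCauchyDevelopment (F c), 𝒟'.IsMaximal) ∧ ∀ 𝒟' : Literature.Geometry.Lorentzian.VacuumCauchyDevelopment (F c), 𝒟'.IsMaximal → Summit.FinalStateConjecture.HasCompleteNullInfinity 𝒟'.toCauchyDevelopment ∧ ∃ (O : Set 𝒟'.carrier) (d : Literature.Geometry.Lorentzian.FinalStateDecomposition 𝒟'.toSpacetime O 2), (∀ i, Literature.Geometry.Lorentzian.Kerr.IsSubextremal (d.mass i) (d.spin i)) ∧ O = Summit.FinalStateConjecture.exteriorOf 𝒟'.toCauchyDevelopment d.charted ∧ Summit.FinalStateConjecture.RaysStayInClosure 𝒟'.toCauchyDevelopment O ∧ Summit.FinalStateConjecture.HasExhaustiveCharts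 d ∧ Summit.FinalStateConjecture.IsFutureOriented d)) ∨ ∃ Z : Literature.Geometry.Lorentzian.SelfSimilarVacuumProfile.{0} ((⊤ : ℕ∞) : WithTop ℕ∞), Z.IsNonflat ∧ Literature.Geometry.Lorentzian.Spacetime.IsTangentProfileAt 𝒟.toSpacetime P Z.toSpacetime Z.past 2 := by
  sorry

/-! ## Causal-order lemmas of the composition -/

section Visibility

variable {E : Type*} [NormedAddCommGroup E] [NormedSpace ℝ E] {H : Type*} [TopologicalSpace H]
  {I : ModelWithCorners ℝ E H} {M : Type*} [TopologicalSpace M] [ChartedSpace H M]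
  [IsManifold I ∞ M] {X : Type*} [TopologicalSpace X] {g : LorentzianMetric I ∞ M}
  {τ : TimeOrientation g} {ι : X → M} [FiniteDimensional ℝ E] [CompleteSpace E] [g.HasLeviCivita]
  {N : NormalField I ι}

omit [CompleteSpace E] in
/-- The chronological past of a set visible from infinity is visible from infinity (pasts are
past sets; Hawking–Ellis 1973, §6.8, p. 217). -/
theorem isVisibleFromInfinity_chronologicalPast' {P : Set M}
    (h : g.IsVisibleFromInfinity τ ι N P) :
    g.IsVisibleFromInfinity τ ι N (g.chronologicalPast τ P) := by
  intro B₀ hB₀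
  obtain ⟨s, hs⟩ := h B₀ hB₀
  refine ⟨s, fun B₁ hB₁ ↦ ?_⟩
  obtain ⟨p, hp, γ, dom, hγ, hbdd, hsoj, hsub⟩ := hs B₁ hB₁
  exact ⟨p, hp, γ, dom, hγ, hbdd, hsoj,
    (LorentzianMetric.chronologicalPast_mono hsub).trans
      (LorentzianMetric.isPastSet_chronologicalPast _)⟩

end Visibility

section TIP

variable {E : Type*} [NormedAddCommGroup E] [NormedSpace ℝ E] {H : Type*} [TopologicalSpace H]
  {I : ModelWithCorners ℝ E H} {n : ℕ∞ω} {M : Type*} [TopologicalSpace M] [ChartedSpace H M]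
  [IsManifold I ∞ M] {g : LorentzianMetric I n M} {τ : TimeOrientation g}

/-- A future-endless timelike curve threading a family of TIPs generates a TIP below all of them
(`I⁻(γ(s))` is a TIP by definition; `γ(s) ⊆ Pₖ` gives `I⁻(γ(s)) ⊆ I⁻(Pₖ) ⊆ Pₖ`). -/
theorem exists_isTIP_subset_of_isFutureEndless' {κ : Sort*} {P : κ → Set M}
    (hP : ∀ k, g.IsTIP τ (P k)) {γ : ℝ → M} {s : Set ℝ} (hs : s.OrdConnected)
    (hγ : g.IsFutureTimelikeCurveOn τ γ s) (he : IsFutureEndless γ s) (hsub : ∀ k, γ '' s ⊆ P k) :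
    ∃ W, g.IsTIP τ W ∧ ∀ k, W ⊆ P k :=
  ⟨g.chronologicalPast τ (γ '' s), ⟨γ, s, hs, hγ, he, rfl⟩, fun k ↦
    (LorentzianMetric.chronologicalPast_mono (hsub k)).trans (hP k).isPastSet⟩

end TIP

/-! ## The kernel-checked composition -/

/-- **`NakedTangentProfile` from the three pieces, hypothesis form** (the implication shape
`A → B → C → NakedTangentProfile`, verbatim the split's glue; no `sorry` in this declaration): fix
an admissible `D` and a maximal development `𝒟` with incomplete `𝓘⁺`, suppose `D` does not exit.
(A) gives a visible endless observer `γ₀`; `W₀ := I⁻(γ₀(s₀))` is a visible TIP; by (B) every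
antitone sequence of TIPs inside `W₀` has a TIP below it, so the landed Zorn reduction gives a
minimal TIP `W ⊆ W₀`, visible by antitonicity, i.e. a first naked point of `𝒟`; (C) at `W` gives
the nonflat smooth self-similar tangent profile. -/
theorem nakedTangentProfile_of_pieces :
    (∀ (X : Type) [TopologicalSpace X] [ChartedSpace Literature.Geometry.Lorentzian.E3 X] [IsManifold (𝓡 3) ((⊤ : ℕ∞) : WithTop ℕ∞) X] [T2Space X] [SecondCountableTopology X] [ConnectedSpace X], ∀ D ∈ Literature.Geometry.Lorentzian.admissibleVacuumData X, ∀ 𝒟 : Literature.Geometry.Lorentzian.VacuumCauchyDevelopment D, 𝒟.IsMaximal → ¬ Summit.FinalStateConjecture.HasCompleteNullInfinity 𝒟.toCauchyDevelopment → (∃ (e : Literature.Geometry.Lorentzian.AFEnd X) (F : EuclideanSpace ℝ (Fin 1) → Literature.Geometry.Lorentzian.InitialDataSet (𝓡 3) X), Literature.Geometry.Lorentzian.InitialDataSet.IsTameDataFamily e 1 F ∧ Literature.Geometry.Lorentzian.InitialDataSet.IsImmersedAtZero 1 F ∧ F 0 = D ∧ Function.Injective F ∧ (∀ c, F c ∈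 Literature.Geometry.Lorentzian.admissibleVacuumData X) ∧ ∃ ε : ℝ, 0 < ε ∧ ∀ c, c ≠ 0 → ‖c‖ < ε → ((∃ 𝒟' : Literature.Geometry.Lorentzian.VacuumCauchyDevelopment (F c), 𝒟'.IsMaximal) ∧ ∀ 𝒟' : Literature.Geometry.Lorentzian.VacuumCauchyDevelopment (F c), 𝒟'.IsMaximal → Summit.FinalStateConjecture.HasCompleteNullInfinity 𝒟'.toCauchyDevelopment ∧ ∃ (O : Set 𝒟'.carrier) (d : Literature.Geometry.Lorentzian.FinalStateDecomposition 𝒟'.toSpacetime O 2), (∀ i, Literature.Geometry.Lorentzian.Kerr.IsSubextremal (d.mass i) (d.spin i)) ∧ O = Summit.FinalStateConjecture.exteriorOf 𝒟'.toCauchyDevelopment d.charted ∧ Summit.FinalStateConjecture.RaysStayInClosure 𝒟'.toCauchyDevelopment O ∧ Summit.FinalStateConjecture.HasExhaustiveCharts d ∧ Summit.FinalStateConjecture.IsFutureOriented d)) ∨ ∃ (γ₀ : ℝ → 𝒟.carrier) (s₀ : Set ℝ), s₀.OrdConnected ∧ 𝒟.metric.IsFutureTimelikeCurveOn 𝒟.timeOrientation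 γ₀ s₀ ∧ Literature.Geometry.Lorentzian.IsFutureEndless γ₀ s₀ ∧ ∀ [𝒟.metric.HasLeviCivita], 𝒟.metric.IsVisibleFromInfinity 𝒟.timeOrientation 𝒟.embed 𝒟.normal (γ₀ '' s₀)) →
    (∀ (X : Type) [TopologicalSpace X] [ChartedSpace Literature.Geometry.Lorentzian.E3 X] [IsManifold (𝓡 3) ((⊤ : ℕ∞) : WithTop ℕ∞) X] [T2Space X] [SecondCountableTopology X] [ConnectedSpace X], ∀ D ∈ Literature.Geometry.Lorentzian.admissibleVacuumData X, ∀ 𝒟 : Literature.Geometry.Lorentzian.VacuumCauchyDevelopment D, 𝒟.IsMaximal → ∀ W₀ : Set 𝒟.carrier, 𝒟.metric.IsTIP 𝒟.timeOrientation W₀ → (∀ [𝒟.metric.HasLeviCivita], 𝒟.metric.IsVisibleFromInfinity 𝒟.timeOrientation 𝒟.embed 𝒟.normal W₀) → ∀ P : ℕ → Set 𝒟.carrier, (∀ k, 𝒟.metric.IsTIP 𝒟.timeOrientation (P k)) → (∀ k, P k ⊆ W₀) → Antitone P → (∃ (e : Literature.Geometry.Lorentzian.AFEnd X) (F : EuclideanSpace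 ℝ (Fin 1) → Literature.Geometry.Lorentzian.InitialDataSet (𝓡 3) X), Literature.Geometry.Lorentzian.InitialDataSet.IsTameDataFamily e 1 F ∧ Literature.Geometry.Lorentzian.InitialDataSet.IsImmersedAtZero 1 F ∧ F 0 = D ∧ Function.Injective F ∧ (∀ c, F c ∈ Literature.Geometry.Lorentzian.admissibleVacuumData X) ∧ ∃ ε : ℝ, 0 < ε ∧ ∀ c, c ≠ 0 → ‖c‖ < ε → ((∃ 𝒟' : Literature.Geometry.Lorentzian.VacuumCauchyDevelopment (F c), 𝒟'.IsMaximal) ∧ ∀ 𝒟' : Literature.Geometry.Lorentzian.VacuumCauchyDevelopment (F c), 𝒟'.IsMaximal → Summit.FinalStateConjecture.HasCompleteNullInfinity 𝒟'.toCauchyDevelopment ∧ ∃ (O : Set 𝒟'.carrier) (d : Literature.Geometry.Lorentzian.FinalStateDecomposition 𝒟'.toSpacetime O 2), (∀ i, Literature.Geometry.Lorentzian.Kerr.IsSubextremal (d.mass i) (d.spin i)) ∧ O = Summit.FinalStateConjecture.exteriorOf 𝒟'.toCauchyDevelopment d.charted ∧ Summit.FinalStateConjecture.RaysStayInClosure 𝒟'.toCauchyDevelopment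 O ∧ Summit.FinalStateConjecture.HasExhaustiveCharts d ∧ Summit.FinalStateConjecture.IsFutureOriented d)) ∨ ∃ (γ : ℝ → 𝒟.carrier) (s : Set ℝ), s.OrdConnected ∧ 𝒟.metric.IsFutureTimelikeCurveOn 𝒟.timeOrientation γ s ∧ Literature.Geometry.Lorentzian.IsFutureEndless γ s ∧ ∀ k, γ '' s ⊆ P k) →
    (∀ (X : Type) [TopologicalSpace X] [ChartedSpace Literature.Geometry.Lorentzian.E3 X] [IsManifold (𝓡 3) ((⊤ : ℕ∞) : WithTop ℕ∞) X] [T2Space X] [SecondCountableTopology X] [ConnectedSpace X], ∀ D ∈ Literature.Geometry.Lorentzian.admissibleVacuumData X, ∀ 𝒟 : Literature.Geometry.Lorentzian.VacuumCauchyDevelopment D, 𝒟.IsMaximal → ∀ P : Set 𝒟.carrier, 𝒟.toCauchyDevelopment.FirstNakedPoint P → (∃ (e : Literature.Geometry.Lorentzian.AFEnd X) (F : EuclideanSpace ℝ (Fin 1) → Literature.Geometry.Lorentzian.InitialDataSet (𝓡 3) X), Literature.Geometry.Lorentzian.InitialDataSet.IsTameDataFamily e 1 F ∧ Literature.Geometry.Lorentzian.InitialDataSet.IsImmersedAtZero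 1 F ∧ F 0 = D ∧ Function.Injective F ∧ (∀ c, F c ∈ Literature.Geometry.Lorentzian.admissibleVacuumData X) ∧ ∃ ε : ℝ, 0 < ε ∧ ∀ c, c ≠ 0 → ‖c‖ < ε → ((∃ 𝒟' : Literature.Geometry.Lorentzian.VacuumCauchyDevelopment (F c), 𝒟'.IsMaximal) ∧ ∀ 𝒟' : Literature.Geometry.Lorentzian.VacuumCauchyDevelopment (F c), 𝒟'.IsMaximal → Summit.FinalStateConjecture.HasCompleteNullInfinity 𝒟'.toCauchyDevelopment ∧ ∃ (O : Set 𝒟'.carrier) (d : Literature.Geometry.Lorentzian.FinalStateDecomposition 𝒟'.toSpacetime O 2), (∀ i, Literature.Geometry.Lorentzian.Kerr.IsSubextremal (d.mass i) (d.spin i)) ∧ O = Summit.FinalStateConjecture.exteriorOf 𝒟'.toCauchyDevelopment d.charted ∧ Summit.FinalStateConjecture.RaysStayInClosure 𝒟'.toCauchyDevelopment O ∧ Summit.FinalStateConjecture.HasExhaustiveCharts d ∧ Summit.FinalStateConjecture.IsFutureOriented d)) ∨ ∃ Z : Literature.Geometry.Lorentzian.SelfSimilarVacuumProfile.{0} ((⊤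 : ℕ∞) : WithTop ℕ∞), Z.IsNonflat ∧ Literature.Geometry.Lorentzian.Spacetime.IsTangentProfileAt 𝒟.toSpacetime P Z.toSpacetime Z.past 2) →
    Summit.FinalStateConjecture.FinalStateConjecture.Theses.HomotheticSurfaceGravity.NakedTangentProfile := by
  intro hA hB hC X _ _ _ _ _ _ D hD 𝒟 hmax hinc
  refine Classical.or_iff_not_imp_left.mpr fun hex ↦ ?_
  -- (A): a visible endless observer
  obtain ⟨γ₀, s₀, hs₀, hγ₀, he₀, hvis₀⟩ := (hA X D hD 𝒟 hmax hinc).resolve_left hex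
  -- the Levi-Civita connection of the smooth metric exists; all instances are proof-irrelevant
  haveI hLC : 𝒟.metric.HasLeviCivita := 𝒟.metric.hasLeviCivita
  -- `W₀ := I⁻(γ₀(s₀))` is a visible TIP
  set W₀ : Set 𝒟.carrier := 𝒟.metric.chronologicalPast 𝒟.timeOrientation (γ₀ '' s₀) with hW₀def
  have hW₀ : 𝒟.metric.IsTIP 𝒟.timeOrientation W₀ := ⟨γ₀, s₀, hs₀, hγ₀, he₀, rfl⟩
  have hW₀vis : ∀ [𝒟.metric.HasLeviCivita],
      𝒟.metric.IsVisibleFromInfinity 𝒟.timeOrientation 𝒟.embed 𝒟.normal W₀ :=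
    fun {_} ↦ isVisibleFromInfinity_chronologicalPast' hvis₀
  -- (B): no cascade inside `W₀`, in the form consumed by the Zorn reduction
  have hchain : ∀ P : ℕ → Set 𝒟.carrier, (∀ k, 𝒟.metric.IsTIP 𝒟.timeOrientation (P k)) →
      (∀ k, P k ⊆ W₀) → Antitone P →
        ∃ W, 𝒟.metric.IsTIP 𝒟.timeOrientation W ∧ ∀ k, W ⊆ P k := by
    intro P hP hPW hanti
    obtain ⟨γ, s, hs, hγ, he, hsub⟩ :=
      (hB X D hD 𝒟 hmax W₀ hW₀ hW₀vis P hP hPW hanti).resolve_left hex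
    exact exists_isTIP_subset_of_isFutureEndless' hP hs hγ he hsub
  -- Zorn on TIPs + countable coinitiality: a minimal TIP inside `W₀`
  obtain ⟨W, hWW₀, hmin⟩ :=
    cauchyDevelopment_exists_isMinimalTIP_subset_of_seq 𝒟.toCauchyDevelopment hW₀ hchain
  -- which is visible (antitonicity), hence a first naked point of `𝒟`
  have hfirst : 𝒟.toCauchyDevelopment.FirstNakedPoint W :=
    fun {_} ↦ hmin.isFirstNakedPoint (hW₀vis.mono hWW₀)
  -- (C): blow up at `W`
  obtain ⟨Z, hZ, htan⟩ := (hC X D hD 𝒟 hmax W hfirst).resolve_left hex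
  exact ⟨W, hfirst, Z, hZ, htan⟩

/-- **The line's composition — the crux BY NAME from the registered stubs** (no hypotheses; `sorry`
only inside `stub_visibleEndlessObserver`, `stub_noTIPCascade`, `stub_profileAtFirstNakedPoint`):
`nakedTangentProfile_of_pieces` applied to the three stubs. -/
theorem NakedTangentProfile_of :
    Summit.FinalStateConjecture.FinalStateConjecture.Theses.HomotheticSurfaceGravity.NakedTangentProfile :=
  nakedTangentProfile_of_pieces stub_visibleEndlessObserver stub_noTIPCascade
    stub_profileAtFirstNakedPoint

end Summit.FinalStateConjecture.FinalStateConjecture.Cruxes.NakedTangentProfile.FirstNakedPointZorn
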